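import Mathlib
import Literature.RepresentationTheory.FiniteGroups.KLRGradedCellularBasis

/-!
# Per-step bound, column half: the column charge right of an entry of a standard Young tableau

Stub `stub_colCharge_abs_le` of line `klr-graded-polynomial-method` (crux
`SnSubsetDichotomy.NoThresholdSubsetTriple`, stmt-MatrixMultiplication-8302).

For a standard Young tableau `T` of shape `μ ⊢ n` (growth sequence `T.1 j = (row, col)` of the
entry `j`) and an entry `k` in column `c`, the *column-parity charge strictly right of `k`*

  `Σ_{columns i > c} (−1)^i · [column i holds an odd number of entries < k]`

has absolute value at most `rowLen 0 − (c + 1)`, the number of columns of the shape strictly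
right of column `c`.

Proof.  Each summand has absolute value `≤ 1`, and it vanishes unless `c < i` and column `i`
holds some entry `j < k`; the cell of such a `j` lies in the diagram, so by down-closure the
cell `(0, i)` does too, i.e. `i < rowLen 0`.  Hence the nonzero summands are indexed by a subset
of the open interval `(c, rowLen 0)`, which has `rowLen 0 − c − 1` elements; finally
`c < rowLen 0` because the cell of `k` itself lies in the diagram.
-/

namespace Summit.MatrixMultiplication.MatrixMultiplication.Theorems

open Literature.NumberTheory.DiophantineGeometry (StdFilling)
open scoped BigOperators

/-- Every column index of a cell of a standard filling of `μ.youngDiagram` is `< rowLen 0`: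
the diagram is down-closed, so the top cell of an occupied column is a cell. [folklore] -/
private theorem col_lt_rowLen_zero {n : ℕ} {μ : Nat.Partition n}
    (T : StdFilling n μ.youngDiagram) (j : Fin n) : (T.1 j).2 < μ.youngDiagram.rowLen 0 := by
  have h : ((T.1 j).1, (T.1 j).2) ∈ μ.youngDiagram := T.mem j
  have h0 : (0, (T.1 j).2) ∈ μ.youngDiagram :=
    μ.youngDiagram.up_left_mem (Nat.zero_le _) le_rfl h
  exact YoungDiagram.mem_iff_lt_rowLen.1 h0

set_option linter.dupNamespace false in
/-- **Per-step bound, column half.** The column-parity charge strictly right of the column of the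
entry `k` of a standard Young tableau of shape `μ ⊢ n` has absolute value at most the number of
columns of the shape strictly right of that column, `rowLen 0 − (col k + 1)`. [folklore] -/
theorem stub_colCharge_abs_le : ∀ (n : ℕ) (μ : Nat.Partition n) (T : StdFilling n μ.youngDiagram) (k : Fin n),
    |∑ i ∈ Finset.range n, (if (T.1 k).2 < i ∧
        Odd ((Finset.univ.filter (fun j : Fin n => j < k ∧ (T.1 j).2 = i)).card) then (-1 : ℤ) ^ i else 0)|
      ≤ (μ.youngDiagram.rowLen 0 : ℤ) - ((T.1 k).2 + 1 : ℕ) := by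
  intro n μ T k
  have hk : (T.1 k).2 < μ.youngDiagram.rowLen 0 := col_lt_rowLen_zero T k
  -- each summand is bounded by the indicator of the open interval `(col k, rowLen 0)`
  have hterm : ∀ i ∈ Finset.range n,
      |(if (T.1 k).2 < i ∧
          Odd ((Finset.univ.filter (fun j : Fin n => j < k ∧ (T.1 j).2 = i)).card)
        then (-1 : ℤ) ^ i else 0)| ≤
      (if i ∈ Finset.Ioo (T.1 k).2 (μ.youngDiagram.rowLen 0) then (1 : ℤ) else 0) := by
    intro i _
    by_cases h1 : (T.1 k).2 < i ∧
        Odd ((Finset.univ.filter (fun j : Fin n => j < k ∧ (T.1 j).2 = i)).card)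
    · have hmem : i ∈ Finset.Ioo (T.1 k).2 (μ.youngDiagram.rowLen 0) := by
        obtain ⟨hci, hodd⟩ := h1
        obtain ⟨j, hj⟩ :=
          (Finset.card_pos.1 hodd.pos :
            (Finset.univ.filter (fun j : Fin n => j < k ∧ (T.1 j).2 = i)).Nonempty)
        have hji : (T.1 j).2 = i := (Finset.mem_filter.1 hj).2.2
        exact Finset.mem_Ioo.2 ⟨hci, hji ▸ col_lt_rowLen_zero T j⟩
      simp only [if_pos h1, if_pos hmem, abs_neg_one_pow, le_refl]
    · rw [if_neg h1, abs_zero]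
      split_ifs <;> norm_num
  refine (Finset.abs_sum_le_sum_abs _ _).trans ((Finset.sum_le_sum hterm).trans ?_)
  rw [Finset.sum_boole]
  calc (((Finset.range n).filter
          (fun i => i ∈ Finset.Ioo (T.1 k).2 (μ.youngDiagram.rowLen 0))).card : ℤ)
      ≤ ((Finset.Ioo (T.1 k).2 (μ.youngDiagram.rowLen 0)).card : ℤ) := by
        exact_mod_cast Finset.card_le_card fun i hi => (Finset.mem_filter.1 hi).2
    _ = (μ.youngDiagram.rowLen 0 : ℤ) - ((T.1 k).2 + 1 : ℕ) := by
        rw [Nat.card_Ioo]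
        omega

end Summit.MatrixMultiplication.MatrixMultiplication.Theorems
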